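import Summits.CriticalPhenomena.PercolationContinuityZ3.Theorems.PercNearOneGluingNoHeavyLowerTailConditionalThreePointAGSet
import Summits.CriticalPhenomena.PercolationContinuityZ3.Theorems.PercNearOneGluingNoHeavyLowerTailSpectatorTriangleRowLeFive
import HarnessLib

/-!
# `NoHeavyLowerTail` (crux stmt-CriticalPhenomena-4575), law-level frontier: the spectator-triangle row `F11y` on EVERY finite weighted graph
# (all `n`) — `CutVertexMinors.condAG` read on the cells of `…SpectatorTriangleRowLeFive`

Support file (prover seat `prim-l12-p1` gen 5; `--supports stmt-CriticalPhenomena-4575`; proofs only, no `def`, no `native_decide`, standard axioms).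

The quadratic row `F11y`, `μ(abc|y)·μ(a|b|c|y) ≥ μ(ab|c|y)μ(ac|b|y) + μ(ab|c|y)μ(a|bc|y) + μ(ac|b|y)μ(a|bc|y)` (`μ(π)` = probability that the open-cluster
partition of `a, b, c, y` is `π`), singled out by prim-bnk-1 gen 13 (memo run/shared/lean/prim/prim-l12/FROM-prim-bnk-1-gen13-COMB2-ROWS.md) as the law-level
family missing from every catalogued cone and proved there for `≤ 5` vertices (`spectatorTriangle_le_five`) resp. `≤ 7` (fibre census), IS Gladkov–Zimin's Cor. 3.5
= the conditional Aas–Gladkov inequality, in the tree since prim-l12-p2 gen 4 as `CutVertexMinors.condAG` / `condAG_isolatedSet_lab` (BHK two-cluster Gibbs-sampler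
transfer `BHK2006_twoSetConditional_transfer` + GZ Thm 2.3).  This file identifies bnk-1's five `y`-isolated cells with the conditioned `M₃`-label events
(`connEvent_cAB_eq`, …) and restates the theorem in that vocabulary:

`spectatorTriangle_all (w) (a b c y : Fin n) : pr w (cAB a b c y) * pr w (cAC a b c y) + pr w (cAB a b c y) * pr w (cBC a b c y) + pr w (cAC a b c y) * pr w (cBC a b c y)
  ≤ pr w (cABC_Y a b c y) * pr w (cNone a b c y)` — every `n`, every weight vector, no distinctness hypotheses (degenerate placements give `0 ≤ 0`).
[cite: GladkovZimin2024HK, Cor. 3.5]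
-/

noncomputable section

open MeasureTheory Set
open Literature.Probability.LatticeModels
open Literature.Probability.Percolation

namespace Summit.CriticalPhenomena.PercolationContinuityZ3.Theorems.SpectatorTriangleRow

open OneCutCert CovTransferCert E3GroupSepCert CutVertexMinors CutVertexMinors.M3Lab
open scoped Classical

variable {n : ℕ}

/-- Reachability in the open graph is symmetric. [folklore] -/
private theorem rs {ω : BondConfig (Fin n)} {x z : Fin n} (h : (openGraph ω).Reachable x z) : (openGraph ω).Reachable z x := h.symm

/-- The conditioning event written with `{a,b,c}` and `{y}`. [this work] -/
theorem mem_isolated_abc_y_iff (a b c y : Fin n) (ω : BondConfig (Fin n)) :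
    ω ∈ {ω : BondConfig (Fin n) | ∀ s ∈ ({a, b, c} : Set (Fin n)), ∀ t ∈ ({y} : Set (Fin n)), ¬ (openGraph ω).Reachable s t} ↔
      ¬ (openGraph ω).Reachable a y ∧ ¬ (openGraph ω).Reachable b y ∧ ¬ (openGraph ω).Reachable c y := by
  simp only [mem_setOf_eq, mem_insert_iff, mem_singleton_iff, forall_eq_or_imp, forall_eq]

/-- `lab3 = top` iff `a ~ b` and `a ~ c`. [this work] -/
theorem lab3_eq_top_iff (a b c : Fin n) (ω : BondConfig (Fin n)) :
    lab3 a b c ω = M3Lab.top ↔ (openGraph ω).Reachable a b ∧ (openGraph ω).Reachable a c := by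
  unfold lab3
  by_cases h1 : (openGraph ω).Reachable a b <;> by_cases h2 : (openGraph ω).Reachable a c <;>
    by_cases h3 : (openGraph ω).Reachable b c <;> simp [h1, h2, h3]

/-- `lab3 = ab` iff `a ~ b` and `a ≁ c`. [this work] -/
theorem lab3_eq_ab_iff (a b c : Fin n) (ω : BondConfig (Fin n)) :
    lab3 a b c ω = M3Lab.ab ↔ (openGraph ω).Reachable a b ∧ ¬ (openGraph ω).Reachable a c := by
  unfold lab3
  by_cases h1 : (openGraph ω).Reachable a b <;> by_cases h2 : (openGraph ω).Reachable a c <;>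
    by_cases h3 : (openGraph ω).Reachable b c <;> simp [h1, h2, h3]

/-- `lab3 = ac` iff `a ≁ b` and `a ~ c`. [this work] -/
theorem lab3_eq_ac_iff (a b c : Fin n) (ω : BondConfig (Fin n)) :
    lab3 a b c ω = M3Lab.ac ↔ ¬ (openGraph ω).Reachable a b ∧ (openGraph ω).Reachable a c := by
  unfold lab3
  by_cases h1 : (openGraph ω).Reachable a b <;> by_cases h2 : (openGraph ω).Reachable a c <;>
    by_cases h3 : (openGraph ω).Reachable b c <;> simp [h1, h2, h3]

/-- `lab3 = bc` iff `a ≁ b`, `a ≁ c` and `b ~ c`. [this work] -/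
theorem lab3_eq_bc_iff (a b c : Fin n) (ω : BondConfig (Fin n)) :
    lab3 a b c ω = M3Lab.bc ↔ ¬ (openGraph ω).Reachable a b ∧ ¬ (openGraph ω).Reachable a c ∧ (openGraph ω).Reachable b c := by
  unfold lab3
  by_cases h1 : (openGraph ω).Reachable a b <;> by_cases h2 : (openGraph ω).Reachable a c <;>
    by_cases h3 : (openGraph ω).Reachable b c <;> simp [h1, h2, h3]

/-- `lab3 = bot` iff no two of `a, b, c` are joined. [this work] -/
theorem lab3_eq_bot_iff (a b c : Fin n) (ω : BondConfig (Fin n)) :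
    lab3 a b c ω = M3Lab.bot ↔ ¬ (openGraph ω).Reachable a b ∧ ¬ (openGraph ω).Reachable a c ∧ ¬ (openGraph ω).Reachable b c := by
  unfold lab3
  by_cases h1 : (openGraph ω).Reachable a b <;> by_cases h2 : (openGraph ω).Reachable a c <;>
    by_cases h3 : (openGraph ω).Reachable b c <;> simp [h1, h2, h3]

/-- `abc|y` as a conditioned-label event. [this work] -/
theorem connEvent_cABC_Y_eq (a b c y : Fin n) : connEvent (cABC_Y a b c y) =
    {ω : BondConfig (Fin n) | ∀ s ∈ ({a, b, c} : Set (Fin n)), ∀ t ∈ ({y} : Set (Fin n)), ¬ (openGraph ω).Reachable s t} ∩ {ω | lab3 a b c ω = M3Lab.top} := by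
  ext ω
  rw [mem_inter_iff, mem_isolated_abc_y_iff, mem_setOf_eq, lab3_eq_top_iff, cABC_Y, connEvent_pAnd, connEvent_pAnd, connEvent_lnk, connEvent_lnk, connEvent_sep]
  simp only [mem_inter_iff, mem_setOf_eq, List.mem_cons, List.not_mem_nil, or_false, exists_eq_left, forall_eq, openConn]
  constructor
  · rintro ⟨hab, hac, hya⟩
    exact ⟨⟨fun h => hya (rs h), fun h => hya (rs (hab.trans h)), fun h => hya (rs (hac.trans h))⟩, hab, hac⟩
  · rintro ⟨⟨hay, _, _⟩, hab, hac⟩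
    exact ⟨hab, hac, fun h => hay (rs h)⟩

/-- `ab|c|y` as a conditioned-label event. [this work] -/
theorem connEvent_cAB_eq (a b c y : Fin n) : connEvent (cAB a b c y) =
    {ω : BondConfig (Fin n) | ∀ s ∈ ({a, b, c} : Set (Fin n)), ∀ t ∈ ({y} : Set (Fin n)), ¬ (openGraph ω).Reachable s t} ∩ {ω | lab3 a b c ω = M3Lab.ab} := by
  ext ω
  rw [mem_inter_iff, mem_isolated_abc_y_iff, mem_setOf_eq, lab3_eq_ab_iff, cAB, connEvent_pAnd, connEvent_pAnd, connEvent_lnk, connEvent_sep, connEvent_sep]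
  simp only [mem_inter_iff, mem_setOf_eq, List.mem_cons, List.not_mem_nil, or_false, exists_eq_left, forall_eq_or_imp, forall_eq, openConn]
  constructor
  · rintro ⟨hab, ⟨hac, hay⟩, hcy⟩
    exact ⟨⟨hay, fun h => hay (hab.trans h), hcy⟩, hab, hac⟩
  · rintro ⟨⟨hay, _, hcy⟩, hab, hac⟩
    exact ⟨hab, ⟨hac, hay⟩, hcy⟩

/-- `ac|b|y` as a conditioned-label event. [this work] -/
theorem connEvent_cAC_eq (a b c y : Fin n) : connEvent (cAC a b c y) =
    {ω : BondConfig (Fin n) | ∀ s ∈ ({a, b, c} : Set (Fin n)), ∀ t ∈ ({y} : Set (Fin n)), ¬ (openGraph ω).Reachable s t} ∩ {ω | lab3 a b c ω = M3Lab.ac} := by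
  ext ω
  rw [mem_inter_iff, mem_isolated_abc_y_iff, mem_setOf_eq, lab3_eq_ac_iff, cAC, connEvent_pAnd, connEvent_pAnd, connEvent_lnk, connEvent_sep, connEvent_sep]
  simp only [mem_inter_iff, mem_setOf_eq, List.mem_cons, List.not_mem_nil, or_false, exists_eq_left, forall_eq_or_imp, forall_eq, openConn]
  constructor
  · rintro ⟨hac, ⟨hab, hay⟩, hby⟩
    exact ⟨⟨hay, hby, fun h => hay (hac.trans h)⟩, hab, hac⟩
  · rintro ⟨⟨hay, hby, _⟩, hab, hac⟩
    exact ⟨hac, ⟨hab, hay⟩, hby⟩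

/-- `a|bc|y` as a conditioned-label event. [this work] -/
theorem connEvent_cBC_eq (a b c y : Fin n) : connEvent (cBC a b c y) =
    {ω : BondConfig (Fin n) | ∀ s ∈ ({a, b, c} : Set (Fin n)), ∀ t ∈ ({y} : Set (Fin n)), ¬ (openGraph ω).Reachable s t} ∩ {ω | lab3 a b c ω = M3Lab.bc} := by
  ext ω
  rw [mem_inter_iff, mem_isolated_abc_y_iff, mem_setOf_eq, lab3_eq_bc_iff, cBC, connEvent_pAnd, connEvent_pAnd, connEvent_lnk, connEvent_sep, connEvent_sep]
  simp only [mem_inter_iff, mem_setOf_eq, List.mem_cons, List.not_mem_nil, or_false, exists_eq_left, forall_eq_or_imp, forall_eq, openConn]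
  constructor
  · rintro ⟨hbc, ⟨hab, hay⟩, hby⟩
    exact ⟨⟨hay, hby, fun h => hby (hbc.trans h)⟩, hab, fun h => hab (h.trans hbc.symm), hbc⟩
  · rintro ⟨⟨hay, hby, _⟩, hab, _, hbc⟩
    exact ⟨hbc, ⟨hab, hay⟩, hby⟩

/-- `a|b|c|y` as a conditioned-label event. [this work] -/
theorem connEvent_cNone_eq (a b c y : Fin n) : connEvent (cNone a b c y) =
    {ω : BondConfig (Fin n) | ∀ s ∈ ({a, b, c} : Set (Fin n)), ∀ t ∈ ({y} : Set (Fin n)), ¬ (openGraph ω).Reachable s t} ∩ {ω | lab3 a b c ω = M3Lab.bot} := by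
  ext ω
  rw [mem_inter_iff, mem_isolated_abc_y_iff, mem_setOf_eq, lab3_eq_bot_iff, cNone, connEvent_pAnd, connEvent_pAnd, connEvent_sep, connEvent_sep, connEvent_sep]
  simp only [mem_inter_iff, mem_setOf_eq, List.mem_cons, List.not_mem_nil, or_false, forall_eq_or_imp, forall_eq, openConn]
  constructor
  · rintro ⟨⟨hab, hac, hay⟩, ⟨hbc, hby⟩, hcy⟩
    exact ⟨⟨hay, hby, hcy⟩, hab, hac, hbc⟩
  · rintro ⟨⟨hay, hby, hcy⟩, hab, hac, hbc⟩
    exact ⟨⟨hab, hac, hay⟩, ⟨hbc, hby⟩, hcy⟩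

/-- `D[y|abc] = {a,b,c ↮ y}`. [this work] -/
theorem connEvent_sep_abc_y (a b c y : Fin n) : connEvent (sep [a, b, c] [y]) =
    {ω : BondConfig (Fin n) | ∀ s ∈ ({a, b, c} : Set (Fin n)), ∀ t ∈ ({y} : Set (Fin n)), ¬ (openGraph ω).Reachable s t} := by
  ext ω
  rw [mem_isolated_abc_y_iff, connEvent_sep]
  simp only [mem_setOf_eq, List.mem_cons, List.not_mem_nil, or_false, forall_eq_or_imp, forall_eq, openConn]

/-- **The spectator-triangle row `F11y` on EVERY finite weighted graph** (all `n`, all weights, all `a b c y : Fin n`):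
`μ(ab|c|y)μ(ac|b|y) + μ(ab|c|y)μ(a|bc|y) + μ(ac|b|y)μ(a|bc|y) ≤ μ(abc|y)μ(a|b|c|y)` in the cell vocabulary of `…SpectatorTriangleRowLeFive` — the all-`n` statement
whose `n ≤ 5` base is `spectatorTriangle_le_five`; it is `CutVertexMinors.condAG` (Gladkov–Zimin Cor. 3.5) read on the cells. [this work] -/
theorem spectatorTriangle_all (w : Sym2 (Fin n) → unitInterval) (a b c y : Fin n) :
    pr w (cAB a b c y) * pr w (cAC a b c y) + pr w (cAB a b c y) * pr w (cBC a b c y) + pr w (cAC a b c y) * pr w (cBC a b c y) ≤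
      pr w (cABC_Y a b c y) * pr w (cNone a b c y) := by
  have h := condAG_isolatedSet_lab w a b c ({y} : Set (Fin n))
  unfold pr
  rw [connEvent_cAB_eq, connEvent_cAC_eq, connEvent_cBC_eq, connEvent_cABC_Y_eq, connEvent_cNone_eq]
  exact h

end Summit.CriticalPhenomena.PercolationContinuityZ3.Theorems.SpectatorTriangleRow
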